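import Literature.NumberTheory.EllipticCurves.PrimaryTorsionGaloisRep
import HarnessLib

/-!
# The `ℤ_p`-action on `A[p^∞]` is jointly continuous (discrete `A[p^∞]`, `p`-adic `ℤ_p`)

Topic `NumberTheory/EllipticCurves`; namespace `Literature.NumberTheory.EllipticCurves.PrimaryTorsion`
(the carrier `PrimaryTorsion A p = A[p^∞]` of `PrimaryTorsionGaloisRep.lean`). `Proofs`-style file:
ONE theorem, no definition, no named fact, no instance, no `sorry`.

The `ℤ_p`-module structure on `A[p^∞]` (`PrimaryTorsion.instModule`: `c • a = (c mod p^{k(a)}) • a`,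
the tree's `IwasawaDual.zpT`) makes `A[p^∞]`, with its DISCRETE topology, a topological
`ℤ_p`-module: the action map `ℤ_p × A[p^∞] → A[p^∞]` is jointly continuous, because for fixed `a`
killed by `p^k` the orbit map `c ↦ c • a` factors through the continuous reduction
`ℤ_p → ℤ/p^k` (`PadicInt.continuous_toZModPow`). This is the binder
`[ContinuousSMul ℤ_[p] (PrimaryTorsion (geomPoints W) p)]` of the cell `bsd-stepL` files on
`H¹(K_w, E[p^∞])` (`JetchevSkinnerWan2017/SigmaLocalTotallySplitProofs.lean`, L3 of the discharge
of the local `Σ`-atom), discharged once and for all (`ContinuousSMul` is a `Prop`; use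
`haveI := PrimaryTorsion.continuousSMul`).

References: J.-P. Serre, *Abelian ℓ-adic representations and elliptic curves* (1968), Ch. I §1.2
("`E_{ℓ^∞}` … the `ℤ_ℓ`-module … on which `G` acts continuously"); S. Lang, *Cyclotomic Fields I
and II* (1990), Ch. 5 §1 (the action of `ℤ_p = lim ℤ/p^k` on `p`-power torsion).
-/

noncomputable section

open Topology

universe u

namespace Literature.NumberTheory.EllipticCurves.PrimaryTorsion

variable {A : Type u} [AddCommGroup A] {p : ℕ} [Fact p.Prime]

/-- **`ℤ_p` acts continuously on the discrete module `A[p^∞]`**: for `a` killed by `p^k`,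
`c • a = (c mod p^k) • a` depends on `c` only through the continuous reduction `ℤ_p → ℤ/p^kℤ`,
so the action map is locally constant in `c` and, `A[p^∞]` being discrete, jointly continuous.
[cite: Serre1968, Ch. I §1.2 (the `ℤ_ℓ`-module `E_{ℓ^∞}`)] [cite: Lang1990, Ch. 5 §1] -/
theorem continuousSMul : ContinuousSMul ℤ_[p] (PrimaryTorsion A p) := by
  refine ⟨continuous_prod_of_discrete_right.2 fun a => ?_⟩
  -- the orbit map `c ↦ c • a` factors through `ℤ_p → ZMod (p ^ a.level)`
  have hfac : (fun c : ℤ_[p] => c • a) =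
      (fun n : ZMod (p ^ a.level) => PrimaryTorsion.mk (n.val • (a : A)) a.level
        (by rw [smul_comm, a.level_spec, smul_zero])) ∘ PadicInt.toZModPow a.level := by
    funext c
    exact PrimaryTorsion.ext (by rw [val_smul, IwasawaDual.zpT_def]; rfl)
  rw [hfac]
  exact continuous_of_discreteTopology.comp
    (Literature.NumberTheory.GaloisRepresentations.PadicInt.continuous_toZModPow p a.level)

end Literature.NumberTheory.EllipticCurves.PrimaryTorsion

end
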